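import Literature.Probability.Percolation.QuadCrossingContinuityCaseTwoTame3
import Literature.Probability.Percolation.QuadCrossingContinuityCaseTwoTameAll
import HarnessLib

/-!
# Schramm–Smirnov Lemma 6.1, case (2): tame quads without the cut point, all sub-cases

Topic `Probability/Percolation`; proofs file towards the named fact `SchrammSmirnov2011_lemma_6_1`
(`QuadCrossingContinuity.lean`; O. Schramm, S. Smirnov, *On the scaling limits of planar
percolation*, Ann. Probab. 39 (2011) 1768–1814, arXiv:1101.5820, Lemma 6.1 (2) and its proof,
pp. 21–23, sub-cases (i) `d ≤ 4δ`, (ii) `d = d₀ > 4δ`, (iii) `d = d₁ > 4δ`).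

`QuadCrossingContinuityCaseTwoTameAll.lean` combines the sub-cases of case (2) under the four
hypotheses T1–T4 of `QuadCrossingContinuityCaseTwoTame.lean`.  This file is the same combination
with the cut point (T2) removed, using the product form without cut point
`measureReal_symmDiff_le_mul_of_isPerturbationTwo_of_tame₃` (`QuadCrossingContinuityCaseTwoTame3.lean`)
in place of the one-sided product form: for pairs `(Q, Q')` satisfying condition (2) at scale `ρ`,
lattice tameness of `[Q]` (T1), the chord–arc free side (T3) and local star-shapedness at free-side
points (T4), in the regime `K ρ ≤ c · d(Q)`, `μ_η(⊞_Q Δ ⊞_{Q'}) ≤ 3 (C K ρ / d(Q))^α`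
(`real_symmDiff_crossedEvent_le_of_isPerturbationTwo_of_tame₃_all`).  The case analysis is that of
the printed proof ((ii) via `…_of_sideDist_one_le`, `d₀ ≤ ρ` via `…_of_sideDist_zero_le`, (iii) via
the product form times the a-priori bound `P(⊞_{Q'}) ≤ (C d₁/d₀)^α`).  Everything is proved; no
named fact is introduced.

## References

* O. Schramm, S. Smirnov, Ann. Probab. 39 (2011) 1768–1814, arXiv:1101.5820, Lemma 6.1 and its
  proof. [SchrammSmirnov2011]
-/

noncomputable section

open Set Metric Filter Function
open _root_.MeasureTheory _root_.Topology
open scoped ENNReal symmDiff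
open Literature.Probability.LatticeModels
open Literature.Topology.PlaneTopology

namespace Literature.Probability.Percolation

namespace QuadCrossing

variable {D : Set ℂ}

/-- `x^{αᵢ} ≤ 3 y^α` for `0 < x ≤ 1`, `x ≤ y`, `0 < α ≤ αᵢ`. [folklore] -/
theorem rpow_le_three_mul_rpow {x y α αi : ℝ} (hx0 : 0 < x) (hx1 : x ≤ 1) (hα : 0 < α)
    (hαi : α ≤ αi) (hxy : x ≤ y) : x ^ αi ≤ 3 * y ^ α := by
  have h := rpow_le_two_mul_rpow hx0 hx1 hα hαi hxy
  have h3 : 0 ≤ y ^ α := Real.rpow_nonneg (hx0.le.trans hxy) _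
  linarith

/-- `3 x^{α₁} m ≤ 3 y^α` for `0 < x ≤ 1`, `m ≤ 1`, `x ≤ y`, `0 < α ≤ α₁`. [folklore] -/
theorem three_mul_rpow_mul_le {x y m α α₁ : ℝ} (hx0 : 0 < x) (hx1 : x ≤ 1)
    (hm1 : m ≤ 1) (hα : 0 < α) (hα₁ : α ≤ α₁) (hxy : x ≤ y) :
    3 * x ^ α₁ * m ≤ 3 * y ^ α := by
  have h1 : x ^ α₁ ≤ x ^ α := Real.rpow_le_rpow_of_exponent_ge hx0 hx1 hα₁
  have h2 : x ^ α ≤ y ^ α := Real.rpow_le_rpow hx0.le hxy hα.le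
  have h4 : 0 ≤ x ^ α₁ := Real.rpow_nonneg hx0.le _
  have h5 : x ^ α₁ * m ≤ x ^ α₁ * 1 := mul_le_mul_of_nonneg_left hm1 h4
  nlinarith

/-- `3 x^{α₁} m ≤ 3 y^α` for `0 < x ≤ 1`, `0 < z ≤ 1`, `0 ≤ m ≤ z^{α₄}`, `x z ≤ y`,
`0 < α ≤ α₁, α₄`. [folklore] -/
theorem three_mul_rpow_mul_le_of_le_rpow {x y z m α α₁ α₄ : ℝ} (hx0 : 0 < x) (hx1 : x ≤ 1)
    (hz0 : 0 < z) (hz1 : z ≤ 1) (hm0 : 0 ≤ m) (hmz : m ≤ z ^ α₄) (hα : 0 < α) (hα₁ : α ≤ α₁)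
    (hα₄ : α ≤ α₄) (hxz : x * z ≤ y) : 3 * x ^ α₁ * m ≤ 3 * y ^ α := by
  have h := two_mul_rpow_mul_le_of_le_rpow hx0 hx1 hz0 hz1 hm0 hmz hα hα₁ hα₄ hxz
  linarith
set_option maxHeartbeats 400000 in
/-- **Schramm–Smirnov Lemma 6.1, case (2), tame quads WITHOUT the cut point, all sub-cases** (see
the module docstring): there are `α, C, c > 0` such that for every pair `(Q, Q')` satisfying
condition (2) at scale `ρ`, lattice tameness of `[Q]`, the chord–arc free side with constant `K ≥ 1`
and local star-shapedness at free-side points, in the regime `K ρ ≤ c · d(Q)`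
(`d(Q) = max{d₀(Q), d₁(Q)}`), for every mesh `0 < η < ρ`, `μ_η(⊞_Q Δ ⊞_{Q'}) ≤ 3 (C K ρ / d(Q))^α`.
[cite: SchrammSmirnov2011, Lemma 6.1 (2) and its proof, (i)–(iii), eq. (6.1)–(6.5)] -/
theorem real_symmDiff_crossedEvent_le_of_isPerturbationTwo_of_tame₃_all :
    ∃ α C c : ℝ, 0 < α ∧ 0 < C ∧ 0 < c ∧
      ∀ (D : Set ℂ) (Q Q' : Quad D) (ρ K : ℝ), 0 < ρ → 1 ≤ K → K * ρ ≤ c * Q.sizeParam →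
        Q.IsPerturbationTwo Q' ρ →
        (∀ η : ℝ, 0 < η → η < ρ → ∀ a b : Site 2, (zdGraph 2).Adj a b →
          IsPreconnected (segment ℝ (meshPoint (η * Real.sqrt 2) a) (meshPoint (η * Real.sqrt 2) b) ∩
            Q.carrier)) →
        (∀ s t : unitInterval, dist (Q' (1, s)) (Q' (1, t)) ≤ ρ → ∀ u : unitInterval,
          ((s : ℝ) ≤ u ∧ (u : ℝ) ≤ t ∨ (t : ℝ) ≤ u ∧ (u : ℝ) ≤ s) →
            dist (Q' (1, u)) (Q' (1, s)) ≤ K * ρ) →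
        (∀ x ∈ Q'.side 2, ∃ r > 0, ∀ u ∈ Q'.carrier, u ∈ ball x r → segment ℝ x u ⊆ Q'.carrier) →
        ∀ η : ℝ, 0 < η → η < ρ →
          (squareCrossingLaw D η : Measure (QuadConfig D)).real
              (symmDiff (QuadConfig.crossedEvent Q) (QuadConfig.crossedEvent Q')) ≤
            3 * ((C * K * ρ) / Q.sizeParam) ^ α := by
  -- the four ingredients
  obtain ⟨α₁, C₁, c₁, hα₁, hC₁, hc₁, hT⟩ := measureReal_symmDiff_le_mul_of_isPerturbationTwo_of_tame₃
  obtain ⟨α₂, C₂, c₂, hα₂, hC₂, hc₂, hS⟩ :=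
    real_symmDiff_crossedEvent_le_of_isPerturbationTwo_of_sideDist_one_le
  obtain ⟨α₃, C₃, c₃, hα₃, hC₃, hc₃, hZ⟩ :=
    real_symmDiff_crossedEvent_le_of_isPerturbationTwo_of_sideDist_zero_le
  obtain ⟨α₄, c₀, hα₄, hc₀, hRSW⟩ := annulusOpenCrossing_half_le_holds
  -- constants
  set C₆ : ℝ := 5 + 2 * c₀ with hC₆
  have hC₆pos : 0 < C₆ := by rw [hC₆]; linarith
  set C₄ : ℝ := 32 * C₆ with hC₄
  have hC₄pos : 0 < C₄ := by rw [hC₄]; positivity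
  set C₅ : ℝ := 64 * C₆ with hC₅
  have hC₅pos : 0 < C₅ := by rw [hC₅]; positivity
  have hC₄C₅ : C₄ ≤ C₅ := by rw [hC₄, hC₅]; linarith
  -- the threshold constant `c'`
  set c' : ℝ := min (min c₁ c₃) (min C₁⁻¹ 1) with hc'
  have hc'pos : 0 < c' := by rw [hc']; exact lt_min (lt_min hc₁ hc₃) (lt_min (inv_pos.2 hC₁) one_pos)
  have hc'c₁ : c' ≤ c₁ := by rw [hc']; exact (min_le_left _ _).trans (min_le_left _ _)
  have hc'c₃ : c' ≤ c₃ := by rw [hc']; exact (min_le_left _ _).trans (min_le_right _ _)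
  have hc'C₁ : c' ≤ C₁⁻¹ := by rw [hc']; exact (min_le_right _ _).trans (min_le_left _ _)
  have hc'1 : c' ≤ 1 := by rw [hc']; exact (min_le_right _ _).trans (min_le_right _ _)
  have hc'C₁' : C₁ * c' ≤ 1 := by
    have := mul_le_mul_of_nonneg_left hc'C₁ hC₁.le
    rwa [mul_inv_cancel₀ hC₁.ne'] at this
  -- the exponent and the constant of the conclusion
  set α : ℝ := min (min α₁ α₂) (min α₃ α₄) with hαdef
  have hαpos : 0 < α := by rw [hαdef]; exact lt_min (lt_min hα₁ hα₂) (lt_min hα₃ hα₄)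
  have hαα₁ : α ≤ α₁ := by rw [hαdef]; exact (min_le_left _ _).trans (min_le_left _ _)
  have hαα₂ : α ≤ α₂ := by rw [hαdef]; exact (min_le_left _ _).trans (min_le_right _ _)
  have hαα₃ : α ≤ α₃ := by rw [hαdef]; exact (min_le_right _ _).trans (min_le_left _ _)
  have hαα₄ : α ≤ α₄ := by rw [hαdef]; exact (min_le_right _ _).trans (min_le_right _ _)
  set Cf : ℝ := max (max (C₂ / c') C₃) (C₁ * C₅) with hCf
  have hCf₂ : C₂ / c' ≤ Cf := by rw [hCf]; exact (le_max_left _ _).trans (le_max_left _ _)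
  have hCf₃ : C₃ ≤ Cf := by rw [hCf]; exact (le_max_right _ _).trans (le_max_left _ _)
  have hCf₅ : C₁ * C₅ ≤ Cf := by rw [hCf]; exact le_max_right _ _
  have hCfpos : 0 < Cf := lt_of_lt_of_le (div_pos hC₂ hc'pos) hCf₂
  -- the regime constant `c`
  set c : ℝ := min (min (c' * c₂) (c' / C₂)) (min (min (1 / C₃) (1 / (C₁ * C₅))) (min (1 / 64) (c' / 2)))
    with hcdef
  have hcpos : 0 < c := by
    rw [hcdef]
    refine lt_min (lt_min (mul_pos hc'pos hc₂) (div_pos hc'pos hC₂))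
      (lt_min (lt_min ?_ ?_) (lt_min ?_ ?_))
    · positivity
    · positivity
    · norm_num
    · positivity
  have hc_1 : c ≤ c' * c₂ := by rw [hcdef]; exact (min_le_left _ _).trans (min_le_left _ _)
  have hc_2 : c ≤ c' / C₂ := by rw [hcdef]; exact (min_le_left _ _).trans (min_le_right _ _)
  have hc_3 : c ≤ 1 / C₃ := by
    rw [hcdef]; exact (min_le_right _ _).trans ((min_le_left _ _).trans (min_le_left _ _))
  have hc_4 : c ≤ 1 / (C₁ * C₅) := by
    rw [hcdef]; exact (min_le_right _ _).trans ((min_le_left _ _).trans (min_le_right _ _))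
  have hc_5 : c ≤ 1 / 64 := by
    rw [hcdef]; exact (min_le_right _ _).trans ((min_le_right _ _).trans (min_le_left _ _))
  have hc_6 : c ≤ c' / 2 := by
    rw [hcdef]; exact (min_le_right _ _).trans ((min_le_right _ _).trans (min_le_right _ _))
  refine ⟨α, Cf, c, hαpos, hCfpos, hcpos, ?_⟩
  intro D Q Q' ρ K hρ hK hρc h2 htame harc hstar η hη hηρ
  have hd₀pos : 0 < Q.sideDist 0 := Q.sideDist_pos 0
  have hd₁pos : 0 < Q.sideDist 1 := Q.sideDist_pos 1
  have hdpos : 0 < Q.sizeParam := Q.sizeParam_pos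
  have hdmax : Q.sizeParam = max (Q.sideDist 0) (Q.sideDist 1) := rfl
  have hKpos : 0 < K := by linarith
  have hKρpos : 0 < K * ρ := mul_pos hKpos hρ
  have hρKρ : ρ ≤ K * ρ := le_mul_of_one_le_left hρ.le hK
  -- Case A: `d₁ ≤ K ρ / c'` — sub-case (ii) at scale `K ρ / c'`
  have hρ₂pos : 0 < K * ρ / c' := div_pos hKρpos hc'pos
  have hρρ₂ : ρ ≤ K * ρ / c' := by
    rw [le_div_iff₀ hc'pos]
    calc ρ * c' ≤ ρ * 1 := by gcongr
      _ ≤ K * ρ := by linarith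
  have hcc' : c < c' := by linarith
  by_cases hA : Q.sideDist 1 ≤ K * ρ / c'
  · -- here `d = d₀`
    have hlt : Q.sideDist 1 < Q.sizeParam := by
      have h1 : Q.sideDist 1 * c' ≤ K * ρ := (le_div_iff₀ hc'pos).1 hA
      have h2 : c * Q.sizeParam < c' * Q.sizeParam := mul_lt_mul_of_pos_right hcc' hdpos
      nlinarith
    have hdd₀ : Q.sizeParam = Q.sideDist 0 := by
      rw [hdmax] at hlt ⊢
      rcases le_total (Q.sideDist 0) (Q.sideDist 1) with h | h
      · rw [max_eq_right h] at hlt; exact absurd hlt (lt_irrefl _)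
      · exact max_eq_left h
    have hρ₂c : K * ρ / c' ≤ c₂ * Q.sideDist 0 := by
      rw [← hdd₀, div_le_iff₀ hc'pos]
      calc K * ρ ≤ c * Q.sizeParam := hρc
        _ ≤ (c' * c₂) * Q.sizeParam := by gcongr
        _ = c₂ * Q.sizeParam * c' := by ring
    have hmain := hS D Q Q' (K * ρ / c') hρ₂pos hρ₂c (h2.mono hρρ₂) hA η hη (hηρ.trans_le hρρ₂)
    refine hmain.trans ?_
    rw [← hdd₀]
    obtain ⟨hx0, hx1, hxle⟩ := tame_all_arith_A hC₂ hc'pos hdpos hKρpos hρc hc_2 hCf₂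
    exact rpow_le_three_mul_rpow hx0 hx1 hαpos hαα₂ hxle
  -- Case B: `d₁ > K ρ / c'`, i.e. `K ρ < c' d₁`
  push Not at hA
  have hKρd₁ : K * ρ < c' * Q.sideDist 1 := by
    have := (div_lt_iff₀ hc'pos).1 hA; linarith
  have hρd₁ : ρ < Q.sideDist 1 := by
    have : c' * Q.sideDist 1 ≤ 1 * Q.sideDist 1 := mul_le_mul_of_nonneg_right hc'1 hd₁pos.le
    linarith
  by_cases hB1 : Q.sideDist 0 ≤ ρ
  · -- Case B1: `d₀ ≤ ρ` — the fixed-centre closed arm; here `d = d₁`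
    have hdd₁ : Q.sizeParam = Q.sideDist 1 := by
      rw [hdmax]; exact max_eq_right (by linarith)
    have hρc₃ : ρ ≤ c₃ * Q.sideDist 1 := by
      have : c' * Q.sideDist 1 ≤ c₃ * Q.sideDist 1 := mul_le_mul_of_nonneg_right hc'c₃ hd₁pos.le
      linarith
    have hmain := hZ D Q Q' ρ hρ hρc₃ h2 hB1 η hη hηρ
    refine hmain.trans ?_
    rw [← hdd₁]
    have hρc' : K * ρ ≤ c * Q.sizeParam := hρc
    obtain ⟨hx0, hx1, hxle⟩ := tame_all_arith_B1 hC₃ hdpos hρ hK hρc' hc_3 hCf₃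
    exact rpow_le_three_mul_rpow hx0 hx1 hαpos hαα₃ hxle
  -- Case B2: `ρ < d₀` — the lowest-crossing theorem, product form
  push Not at hB1
  have hKρc₁ : K * ρ ≤ c₁ * Q.sideDist 1 := by
    have : c' * Q.sideDist 1 ≤ c₁ * Q.sideDist 1 := mul_le_mul_of_nonneg_right hc'c₁ hd₁pos.le
    linarith
  have hprod := hT D Q Q' ρ K hρ hK hKρc₁ hB1 h2 htame harc hstar η hη hηρ
  refine (real_squareCrossingLaw_symmDiff_le D η Q Q').trans (hprod.trans ?_)
  set μ := bondPercolation (zdGraph 2) half with hμ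
  set B : Set (BondConfig (Site 2)) := {ω | Q' ∈ z2QuadConfig D (η * Real.sqrt 2) ω} with hB
  have hB0 : 0 ≤ μ.real B := measureReal_nonneg
  have hB1' : μ.real B ≤ 1 := measureReal_le_one
  obtain ⟨hy0, hy1⟩ := tame_all_arith_B2 hC₁ hd₁pos hKρpos hKρd₁ hc'C₁'
  by_cases hB2 : Q.sideDist 0 ≤ C₅ * Q.sideDist 1
  · -- Case B2a: `d₀ ≤ C₅ d₁`, hence `d ≤ C₅ d₁`; drop the factor `P(⊞_{Q'}) ≤ 1`
    have hd₁C₅ : Q.sideDist 1 ≤ C₅ * Q.sideDist 1 := by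
      have : 1 * Q.sideDist 1 ≤ C₅ * Q.sideDist 1 :=
        mul_le_mul_of_nonneg_right (by rw [hC₅]; linarith) hd₁pos.le
      linarith
    have hdC₅ : Q.sizeParam ≤ C₅ * Q.sideDist 1 := by rw [hdmax]; exact max_le hB2 hd₁C₅
    have hxle : C₁ * K * ρ / Q.sideDist 1 ≤ Cf * K * ρ / Q.sizeParam := by
      rw [div_le_div_iff₀ hd₁pos hdpos]
      calc C₁ * K * ρ * Q.sizeParam ≤ C₁ * K * ρ * (C₅ * Q.sideDist 1) := by gcongr
        _ = (C₁ * C₅) * K * ρ * Q.sideDist 1 := by ring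
        _ ≤ Cf * K * ρ * Q.sideDist 1 := by gcongr
    exact three_mul_rpow_mul_le hy0 hy1 hB1' hαpos hαα₁ hxle
  -- Case B2b: `d₀ > C₅ d₁` — multiply by the a-priori bound `P(⊞_{Q'}) ≤ (C₄ d₁ / d₀)^α₄`
  push Not at hB2
  have hC₆d : 64 * (C₆ * Q.sideDist 1) < Q.sideDist 0 := by
    have : C₅ * Q.sideDist 1 = 64 * (C₆ * Q.sideDist 1) := by rw [hC₅]; ring
    linarith
  have hC₆d₁ : 5 * Q.sideDist 1 ≤ C₆ * Q.sideDist 1 :=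
    mul_le_mul_of_nonneg_right (by rw [hC₆]; linarith) hd₁pos.le
  have hd₁d₀ : 320 * Q.sideDist 1 < Q.sideDist 0 := by linarith
  have hdd₀ : Q.sizeParam = Q.sideDist 0 := by
    rw [hdmax]; exact max_eq_left (by linarith)
  -- the mesh
  have hδ'pos : 0 < η * Real.sqrt 2 := mul_pos hη (Real.sqrt_pos.2 (by norm_num))
  have hsqrt2 : Real.sqrt 2 < 2 := by
    rw [show (2 : ℝ) = Real.sqrt 4 by rw [show (4 : ℝ) = 2 ^ 2 by norm_num, Real.sqrt_sq (by norm_num)]]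
    exact Real.sqrt_lt_sqrt (by norm_num) (by norm_num)
  have hδ'ρ : η * Real.sqrt 2 < 2 * ρ := by
    calc η * Real.sqrt 2 < ρ * 2 := mul_lt_mul'' hηρ hsqrt2 hη.le (Real.sqrt_nonneg _)
      _ = 2 * ρ := by ring
  have hρd₀ : 64 * ρ ≤ Q.sideDist 0 := by
    have hh : K * ρ ≤ c * Q.sideDist 0 := by rw [← hdd₀]; exact hρc
    have hc64 : c * Q.sideDist 0 ≤ (1 / 64) * Q.sideDist 0 :=
      mul_le_mul_of_nonneg_right hc_5 hd₀pos.le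
    linarith
  -- the a-priori bound
  obtain ⟨hcar, h0, h1, h3, hjoin⟩ := h2
  obtain ⟨x₁, hx₁, x₃, hx₃, τ, hτ, hτdiam⟩ := Q.exists_transversal_diam_lt
  have hD₁ : Metric.diam (range τ) ≤ 2 * Q.sideDist 1 := hτdiam.le
  have hDR : 2 * Q.sideDist 1 + ρ < Q.sideDist 0 / 16 := by linarith
  have hR2 : 2 * (Q.sideDist 0 / 16) < Q.sideDist 0 - ρ := by linarith
  set r₄ : ℝ := max (2 * Q.sideDist 1 + ρ + η * Real.sqrt 2) (c₀ * (η * Real.sqrt 2)) with hr₄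
  have hBE : B ⊆ annulusOpenCrossing x₁ (η * Real.sqrt 2) r₄ (Q.sideDist 0 / 16 - η * Real.sqrt 2) :=
      fun ω hω => by
    rw [hB, mem_setOf_eq, mem_z2QuadConfig_iff_exists_isCrossing hδ'pos] at hω
    obtain ⟨K₀, hK₀, hK₀O⟩ := hω
    exact annulusOpenCrossing_mono_left x₁ _ (le_max_left _ _) _
      (Quad.mem_annulusOpenCrossing_of_isCrossing_inner hδ'pos hρ.le hcar h0 hjoin hx₁ hx₃ τ hτ hD₁
        hDR hR2 hK₀ hK₀O)
  have hr₄δ : c₀ * (η * Real.sqrt 2) ≤ r₄ := le_max_right _ _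
  have hc₀δ : c₀ * (η * Real.sqrt 2) ≤ c₀ * (2 * Q.sideDist 1) :=
    mul_le_mul_of_nonneg_left (by linarith) hc₀.le
  have hr₄le : r₄ ≤ C₆ * Q.sideDist 1 := by
    have hC₆eq : C₆ * Q.sideDist 1 = 5 * Q.sideDist 1 + c₀ * (2 * Q.sideDist 1) := by rw [hC₆]; ring
    rw [hr₄, max_le_iff, hC₆eq]
    have hc₀d₁ : 0 ≤ c₀ * (2 * Q.sideDist 1) := by positivity
    constructor
    · linarith
    · linarith
  have hR'ge : Q.sideDist 0 / 32 ≤ Q.sideDist 0 / 16 - η * Real.sqrt 2 := by linarith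
  have h2r₄ : 2 * r₄ ≤ Q.sideDist 0 / 16 - η * Real.sqrt 2 := by linarith
  have hr₄pos : 0 < r₄ := lt_of_lt_of_le (by positivity) (le_max_right _ _)
  have hapriori : μ.real B ≤ (C₄ * Q.sideDist 1 / Q.sideDist 0) ^ α₄ := by
    have hmono : μ.real B ≤
        μ.real (annulusOpenCrossing x₁ (η * Real.sqrt 2) r₄ (Q.sideDist 0 / 16 - η * Real.sqrt 2)) :=
      measureReal_mono hBE (measure_ne_top _ _)
    refine hmono.trans ((hRSW x₁ _ r₄ _ hδ'pos hr₄δ h2r₄).trans ?_)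
    have hbase : r₄ / (Q.sideDist 0 / 16 - η * Real.sqrt 2) ≤ C₄ * Q.sideDist 1 / Q.sideDist 0 := by
      rw [div_le_div_iff₀ (by linarith) hd₀pos]
      have h1 : r₄ * Q.sideDist 0 ≤ (C₆ * Q.sideDist 1) * Q.sideDist 0 :=
        mul_le_mul_of_nonneg_right hr₄le hd₀pos.le
      have h2 : (C₆ * Q.sideDist 1) * (Q.sideDist 0 / 32) ≤
          (C₆ * Q.sideDist 1) * (Q.sideDist 0 / 16 - η * Real.sqrt 2) :=
        mul_le_mul_of_nonneg_left hR'ge (by positivity)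
      have h3 : C₄ * Q.sideDist 1 * (Q.sideDist 0 / 16 - η * Real.sqrt 2) =
          32 * ((C₆ * Q.sideDist 1) * (Q.sideDist 0 / 16 - η * Real.sqrt 2)) := by rw [hC₄]; ring
      rw [h3]
      linarith
    exact Real.rpow_le_rpow (div_nonneg hr₄pos.le (by linarith)) hbase hα₄.le
  -- the base of the second factor `≤ 1`, and the product of the two bases
  have hz0 : 0 < C₄ * Q.sideDist 1 / Q.sideDist 0 := by positivity
  have hz1 : C₄ * Q.sideDist 1 / Q.sideDist 0 ≤ 1 := by
    rw [div_le_one hd₀pos]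
    have : C₄ * Q.sideDist 1 = 32 * (C₆ * Q.sideDist 1) := by rw [hC₄]; ring
    linarith
  have hxz : C₁ * K * ρ / Q.sideDist 1 * (C₄ * Q.sideDist 1 / Q.sideDist 0) ≤
      Cf * K * ρ / Q.sizeParam := by
    have heq : C₁ * K * ρ / Q.sideDist 1 * (C₄ * Q.sideDist 1 / Q.sideDist 0) =
        (C₁ * C₄) * K * ρ / Q.sizeParam := by
      rw [hdd₀]; field_simp
    rw [heq]
    apply div_le_div_of_nonneg_right _ hdpos.le
    have hCf : C₁ * C₄ ≤ Cf :=
      calc C₁ * C₄ ≤ C₁ * C₅ := by gcongr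
        _ ≤ Cf := hCf₅
    calc C₁ * C₄ * K * ρ = (C₁ * C₄) * (K * ρ) := by ring
      _ ≤ Cf * (K * ρ) := by gcongr
      _ = Cf * K * ρ := by ring
  exact three_mul_rpow_mul_le_of_le_rpow hy0 hy1 hz0 hz1 hB0 hapriori hαpos hαα₁ hαα₄ hxz


end QuadCrossing

end Literature.Probability.Percolation
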